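import Summits.Ventures.PercRepro.SixFourResidueFourPlaneLineTWDefs

/-!
# PercRepro — C-025 at `(6,4)`: the TW-100 table at `t = 4`, `69 ≤ g ≤ 82` (p3, gen 11 — §21.18.7)

The per-`g` checks `minCheckAll g` (the minimiser `m*(g,q)` of `L(g,q,m)/C(m,2)` is a minimiser, integer form) and
`twCheckAll g` (the cell inequality `w′(g,n,e,s) ≥ 0` of Lemma TW with `μ = L(m*)/C(m*,2)`, integer form) for `69 ≤ g ≤ 82`,
by `decide +kernel`; see `SixFourResidueFourPlaneLineTWDefs.lean` for the definitions and the transfer lemmas.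
-/

namespace PercRepro.SixFour

set_option maxRecDepth 20000

/-- `minCheckAll 69` (by `decide +kernel`). -/
theorem minCheckAll_69 : minCheckAll 69 := by unfold minCheckAll; decide +kernel
/-- `twCheckAll 69` (by `decide +kernel`). -/
theorem twCheckAll_69 : twCheckAll 69 := by unfold twCheckAll; decide +kernel

/-- `minCheckAll 70` (by `decide +kernel`). -/
theorem minCheckAll_70 : minCheckAll 70 := by unfold minCheckAll; decide +kernel
/-- `twCheckAll 70` (by `decide +kernel`). -/
theorem twCheckAll_70 : twCheckAll 70 := by unfold twCheckAll; decide +kernel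

/-- `minCheckAll 71` (by `decide +kernel`). -/
theorem minCheckAll_71 : minCheckAll 71 := by unfold minCheckAll; decide +kernel
/-- `twCheckAll 71` (by `decide +kernel`). -/
theorem twCheckAll_71 : twCheckAll 71 := by unfold twCheckAll; decide +kernel

/-- `minCheckAll 72` (by `decide +kernel`). -/
theorem minCheckAll_72 : minCheckAll 72 := by unfold minCheckAll; decide +kernel
/-- `twCheckAll 72` (by `decide +kernel`). -/
theorem twCheckAll_72 : twCheckAll 72 := by unfold twCheckAll; decide +kernel

/-- `minCheckAll 73` (by `decide +kernel`). -/
theorem minCheckAll_73 : minCheckAll 73 := by unfold minCheckAll; decide +kernel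
/-- `twCheckAll 73` (by `decide +kernel`). -/
theorem twCheckAll_73 : twCheckAll 73 := by unfold twCheckAll; decide +kernel

/-- `minCheckAll 74` (by `decide +kernel`). -/
theorem minCheckAll_74 : minCheckAll 74 := by unfold minCheckAll; decide +kernel
/-- `twCheckAll 74` (by `decide +kernel`). -/
theorem twCheckAll_74 : twCheckAll 74 := by unfold twCheckAll; decide +kernel

/-- `minCheckAll 75` (by `decide +kernel`). -/
theorem minCheckAll_75 : minCheckAll 75 := by unfold minCheckAll; decide +kernel
/-- `twCheckAll 75` (by `decide +kernel`). -/
theorem twCheckAll_75 : twCheckAll 75 := by unfold twCheckAll; decide +kernel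

/-- `minCheckAll 76` (by `decide +kernel`). -/
theorem minCheckAll_76 : minCheckAll 76 := by unfold minCheckAll; decide +kernel
/-- `twCheckAll 76` (by `decide +kernel`). -/
theorem twCheckAll_76 : twCheckAll 76 := by unfold twCheckAll; decide +kernel

/-- `minCheckAll 77` (by `decide +kernel`). -/
theorem minCheckAll_77 : minCheckAll 77 := by unfold minCheckAll; decide +kernel
/-- `twCheckAll 77` (by `decide +kernel`). -/
theorem twCheckAll_77 : twCheckAll 77 := by unfold twCheckAll; decide +kernel

/-- `minCheckAll 78` (by `decide +kernel`). -/
theorem minCheckAll_78 : minCheckAll 78 := by unfold minCheckAll; decide +kernel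
/-- `twCheckAll 78` (by `decide +kernel`). -/
theorem twCheckAll_78 : twCheckAll 78 := by unfold twCheckAll; decide +kernel

/-- `minCheckAll 79` (by `decide +kernel`). -/
theorem minCheckAll_79 : minCheckAll 79 := by unfold minCheckAll; decide +kernel
/-- `twCheckAll 79` (by `decide +kernel`). -/
theorem twCheckAll_79 : twCheckAll 79 := by unfold twCheckAll; decide +kernel

/-- `minCheckAll 80` (by `decide +kernel`). -/
theorem minCheckAll_80 : minCheckAll 80 := by unfold minCheckAll; decide +kernel
/-- `twCheckAll 80` (by `decide +kernel`). -/
theorem twCheckAll_80 : twCheckAll 80 := by unfold twCheckAll; decide +kernel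

/-- `minCheckAll 81` (by `decide +kernel`). -/
theorem minCheckAll_81 : minCheckAll 81 := by unfold minCheckAll; decide +kernel
/-- `twCheckAll 81` (by `decide +kernel`). -/
theorem twCheckAll_81 : twCheckAll 81 := by unfold twCheckAll; decide +kernel

/-- `minCheckAll 82` (by `decide +kernel`). -/
theorem minCheckAll_82 : minCheckAll 82 := by unfold minCheckAll; decide +kernel
/-- `twCheckAll 82` (by `decide +kernel`). -/
theorem twCheckAll_82 : twCheckAll 82 := by unfold twCheckAll; decide +kernel

/-- `minCheckAll g` for every `69 ≤ g ≤ 82`. -/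
theorem minCheckAll_of_rangeD {g : ℕ} (hg : 69 ≤ g) (hg' : g ≤ 82) : minCheckAll g := by
  interval_cases g
  exacts [minCheckAll_69, minCheckAll_70, minCheckAll_71, minCheckAll_72, minCheckAll_73, minCheckAll_74, minCheckAll_75, minCheckAll_76, minCheckAll_77, minCheckAll_78, minCheckAll_79, minCheckAll_80, minCheckAll_81, minCheckAll_82]

/-- `twCheckAll g` for every `69 ≤ g ≤ 82`. -/
theorem twCheckAll_of_rangeD {g : ℕ} (hg : 69 ≤ g) (hg' : g ≤ 82) : twCheckAll g := by
  interval_cases g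
  exacts [twCheckAll_69, twCheckAll_70, twCheckAll_71, twCheckAll_72, twCheckAll_73, twCheckAll_74, twCheckAll_75, twCheckAll_76, twCheckAll_77, twCheckAll_78, twCheckAll_79, twCheckAll_80, twCheckAll_81, twCheckAll_82]

end PercRepro.SixFour
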